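import Mathlib.GroupTheory.FreeGroup.CyclicallyReduced
import Literature.GroupTheory.CombinatorialGroupTheory.FreeGroupCentralizers
import Literature.IUT.HodgeTheaters.CommensuratorLemmas
import Literature.IUT.HodgeTheaters.TemperedCoveringsCor23LevelsSub
import Literature.IUT.HodgeTheaters.TemperedCoveringsFreeModel
import HarnessLib

/-!
# The B2 law `LevelCommTerminal` of [IUTchI] Cor. 2.3 (i) at levels, at the free-group toy datum

Mochizuki, *Inter-universal Teichmüller theory I*, kurims manuscript (May 2020), §2, Corollary 2.3 (i)
p. 47 ("`Δ^tp_{X,ℍ} ⊆ Δ^tp_X` is commensurably terminal") read at the level `J_i` of the Prop. 2.4 tower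
(p. 50 l. 27–30), i.e. abc-iut-L5-t11's predicate `Prop24Tower.SubgraphLevelData.LevelCommTerminal`
(`TemperedCoveringsCor23LevelsSub.lean`, sub-DAG row B2) ([IUTchI] Cor 2.3(i) p.47)
[claim: Mochizuki2012, status: disputed] (D-0012 claim key; nothing of the series is asserted here).

PROOF-ONLY non-vacuity companion (abc-iut cell, NV-L5 row `Prop24Tower.SubgraphLevelData`, seat
abc-iut-w4-d063; sequel of `TemperedCoveringsFreeModelLevelData.lean`, which certifies the B4/B1 laws at
abc-iut-L5-d4's toy datum `StableCurveTemperedData.FreeModel.toy`).  Here the remaining law B2 is PROVED at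
the toy for every tower whose levels `J_i = ι⁻¹(Ĵ_i) ≤ F₂` have FINITE INDEX (true for the printed
"finite index characteristic open" levels, p. 50 l. 27): `⟨x₀⟩ ∩ J_i` is commensurably terminal in `J_i`.
The group theory is the MALNORMALITY of the maximal cyclic subgroup `⟨x₀⟩` of the free group `F₂`
(`x₀` a basis element): the tree's `FreeGroup.eq_zero_of_conj_zpow_mem_zpowers` (abc-iut cell,
`CombinatorialGroupTheory/FreeGroupCentralizers.lean`, [MKS] Cor. 4.1.6) — an element of `F₂` commensurating
`⟨x₀⟩ ∩ J` conjugates a nontrivial power of `x₀` into `⟨x₀⟩`, hence lies in `⟨x₀⟩`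
(`mem_zpowers_of_mem_commensurator_zpowers_inf`).  Finite index is NEEDED: for a level with
`⟨x₀⟩ ∩ J = 1` (e.g. the normal closure of `x₁`) the law fails, the commensurator of `1` in `J` being `J`.
No definition; nothing here bears on [IUTchIII] Cor. 3.12; instantiated ≠ endorsed.
-/

namespace Literature.IUT.HodgeTheaters

namespace StableCurveTemperedData

namespace FreeModel

open scoped Pointwise
open Literature.GroupTheory.CombinatorialGroupTheory

/-! ### Malnormality of `⟨x₀⟩ ≤ F₂` in commensurator form -/

/-- `x₀ = [0] ∈ F₂` is not a proper power (`ℕ`-exponent form, as the tree's malnormality lemma wants it).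
[claim: Mochizuki2012, status: disputed] -/
theorem x0_not_isPower (t : F2) (k : ℕ) (h : t ^ k = x0) : k = 1 := by
  have hk := FreeGroup.zpow_eq_of_iff (0 : Fin 2) t k (by rw [zpow_natCast]; exact h)
  rcases hk with hk | hk
  · exact_mod_cast hk
  · exfalso; omega

/-- Along an injective homomorphism, membership in a commensurator is preserved:
`a ∈ C_A(T) ⇒ f a ∈ C_B(f T)` (private helper). [folklore] -/
private theorem map_mem_commensurator_of_injective {A B : Type*} [Group A] [Group B] (f : A →* B)
    (hf : Function.Injective f) {T : Subgroup A} {a : A}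
    (ha : a ∈ Subgroup.Commensurable.commensurator T) :
    f a ∈ Subgroup.Commensurable.commensurator (T.map f) := by
  rw [Subgroup.Commensurable.commensurator_mem_iff] at ha ⊢
  rw [← map_conjAct_smul]
  exact ⟨by rw [Subgroup.relIndex_map_map_of_injective _ _ hf]; exact ha.1,
    by rw [Subgroup.relIndex_map_map_of_injective _ _ hf]; exact ha.2⟩

/-- **Malnormality of `⟨x₀⟩` in commensurator form.**  For a subgroup `J ≤ F₂` of finite index, every
element of `F₂` commensurating `⟨x₀⟩ ∩ J` lies in `⟨x₀⟩`: some nontrivial power `x₀^{N}` lies in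
`⟨x₀⟩ ∩ J ∩ g(⟨x₀⟩ ∩ J)g⁻¹` (finite relative index), so `g⁻¹ x₀^{N} g ∈ ⟨x₀⟩`, and the malnormality of the
maximal cyclic `⟨x₀⟩` ([MKS] Cor. 4.1.6, tree `FreeGroup.eq_zero_of_conj_zpow_mem_zpowers`) forces
`g ∈ ⟨x₀⟩`. [claim: Mochizuki2012, status: disputed] -/
theorem mem_zpowers_of_mem_commensurator_zpowers_inf (J : Subgroup F2) (hJ : J.index ≠ 0) {g : F2}
    (hg : g ∈ Subgroup.Commensurable.commensurator (Subgroup.zpowers x0 ⊓ J)) :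
    g ∈ Subgroup.zpowers x0 := by
  haveI : IsMulTorsionFree F2 := inferInstanceAs (IsMulTorsionFree (FreeGroup (Fin 2)))
  set C : Subgroup F2 := Subgroup.zpowers x0 ⊓ J with hC
  -- a positive power of `x₀` in `J`, hence in `C`
  obtain ⟨n, hn0, -, hn⟩ := Subgroup.exists_pow_mem_of_index_ne_zero hJ x0
  have hnC : x0 ^ n ∈ C := ⟨Subgroup.npow_mem_zpowers x0 n, hn⟩
  -- commensurability: a positive power of `x₀ ^ n` lies in `gCg⁻¹ ∩ C`
  rw [Subgroup.Commensurable.commensurator_mem_iff] at hg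
  obtain ⟨m, hm0, -, hm⟩ := Subgroup.exists_pow_mem_of_relIndex_ne_zero hg.1 hnC
  rw [← pow_mul] at hm
  -- so `g⁻¹ x₀^{nm} g ∈ C ⊆ ⟨x₀⟩`
  have hconj : g⁻¹ * x0 ^ ((n * m : ℕ) : ℤ) * g⁻¹⁻¹ ∈ Subgroup.zpowers x0 := by
    have h1 : x0 ^ (n * m) ∈ ConjAct.toConjAct g • C := hm.1
    rw [Subgroup.mem_pointwise_smul_iff_inv_smul_mem, ← map_inv, ConjAct.smul_def,
      ConjAct.ofConjAct_toConjAct] at h1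
    rw [zpow_natCast]
    exact h1.1
  -- malnormality of `⟨x₀⟩`
  by_contra hgx
  have hginv : g⁻¹ ∉ Subgroup.zpowers x0 := fun h => hgx (by simpa using Subgroup.inv_mem _ h)
  have := FreeGroup.eq_zero_of_conj_zpow_mem_zpowers (α := Fin 2) (r := x0) (g := g⁻¹)
    x0_not_isPower hginv hconj
  have : n * m = 0 := by exact_mod_cast this
  rcases Nat.mul_eq_zero.mp this with h | h
  · exact absurd h hn0.ne'
  · exact absurd h hm0.ne'

/-! ### The law B2 at the toy -/

/-- **NV-L5, law B2 `LevelCommTerminal` at the toy.**  For every tower `T` of the toy datum whose levels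
`J_i = ι⁻¹(Ĵ_i)` have finite index in `F₂`, `Δ^tp_{X,ℍ} ∩ J_i = ⟨x₀⟩ ∩ J_i` is commensurably terminal in
`J_i` ([IUTchI] Cor. 2.3 (i) at level `i`): an element of `J_i` commensurating it lies in `⟨x₀⟩`
(`mem_zpowers_of_mem_commensurator_zpowers_inf`, transported along the injection `J_i ↪ Δ^tp_X ↪ F₂`),
hence in `⟨x₀⟩ ∩ J_i`. ([IUTchI] Cor 2.3(i) p.47) [claim: Mochizuki2012, status: disputed] -/
theorem levelCommTerminal_free (T : toy.Prop24Tower)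
    (hfin : ∀ i, ((T.Jhat i).comap toy.ιX).index ≠ 0) :
    Prop24Tower.SubgraphLevelData.LevelCommTerminal (T := T) := by
  intro i
  have mem_deltaTp' : ∀ g : F2, g ∈ toy.DeltaTp := fun g => by
    change g ∈ (1 : F2 →* Gk).ker
    rw [MonoidHom.mem_ker, MonoidHom.one_apply]
  -- notation: `J ≤ Δ^tp_X` the level, `K = Δ^tp_{X,ℍ} ∩ J`, `f : J ↪ F₂`
  set J : Subgroup toy.DeltaTp := toy.levelTp (T.Jhat i) with hJdef
  set K : Subgroup toy.DeltaTp := toy.deltaTpH ⊓ J with hKdef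
  let f : J →* F2 := toy.DeltaTp.subtype.comp J.subtype
  have hf : Function.Injective f := fun a b h => Subtype.ext (Subtype.ext h)
  -- the image of `K ∩ J ⊆ J` in `F₂` is `⟨x₀⟩ ∩ ι⁻¹(Ĵ_i)`
  have hKmap : (K.subgroupOf J).map f ≤ Subgroup.zpowers x0 ⊓ (T.Jhat i).comap toy.ιX := by
    rintro _ ⟨y, hy, rfl⟩
    have hy' : (y : toy.DeltaTp) ∈ toy.deltaTpH ⊓ J :=
      (Subgroup.mem_subgroupOf (H := K) (K := J) (h := y)).mp hy
    obtain ⟨hyH, -⟩ := Subgroup.mem_inf.mp hy'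
    refine ⟨?_, ?_⟩
    · change toy.ρTp (y : toy.DeltaTp) ∈ TpH at hyH
      rw [TpH, ← Subgroup.zpowers_eq_closure] at hyH
      exact hyH
    · exact Subgroup.mem_comap.mpr ((toy.mem_levelTp).mp y.2)
  have hKmap' : Subgroup.zpowers x0 ⊓ (T.Jhat i).comap toy.ιX ≤ (K.subgroupOf J).map f := by
    rintro g ⟨hg0, hgJ⟩
    have hgJ' : (⟨g, mem_deltaTp' g⟩ : toy.DeltaTp) ∈ J :=
      (toy.mem_levelTp).mpr (Subgroup.mem_comap.mp hgJ)
    refine ⟨⟨⟨g, mem_deltaTp' g⟩, hgJ'⟩, ?_, rfl⟩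
    refine (Subgroup.mem_subgroupOf (H := K) (K := J)).mpr (Subgroup.mem_inf.mpr ⟨?_, hgJ'⟩)
    change toy.ρTp ⟨g, mem_deltaTp' g⟩ ∈ TpH
    rw [TpH, ← Subgroup.zpowers_eq_closure]
    exact hg0
  have hKeq : (K.subgroupOf J).map f = Subgroup.zpowers x0 ⊓ (T.Jhat i).comap toy.ιX :=
    le_antisymm hKmap hKmap'
  -- commensurable terminality
  refine ⟨le_antisymm (fun j hj => ?_) (le_commensurator _)⟩
  have hfj : f j ∈ Subgroup.Commensurable.commensurator (Subgroup.zpowers x0 ⊓ (T.Jhat i).comap toy.ιX) := by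
    rw [← hKeq]
    exact map_mem_commensurator_of_injective f hf hj
  have hx0 : f j ∈ Subgroup.zpowers x0 := mem_zpowers_of_mem_commensurator_zpowers_inf _ (hfin i) hfj
  have : f j ∈ (K.subgroupOf J).map f := by
    rw [hKeq]
    exact ⟨hx0, j.2⟩
  rwa [Subgroup.mem_map_iff_mem hf] at this

/-- At the toy, an OPEN level `Ĵ_i ∩ Δ̂_X ⊆ Δ̂_X = F̂₂` (`LevelsOpen`, "finite index … open", p. 50 l. 27)
pulls back to a FINITE-INDEX subgroup `J_i = ι⁻¹(Ĵ_i)` of `F₂` (`F̂₂` is compact, and `F₂ ⧸ J_i` embeds in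
`F̂₂ ⧸ Ĵ_i`). [claim: Mochizuki2012, status: disputed] -/
theorem index_comap_ne_zero_of_levelsOpen (T : toy.Prop24Tower) (hO : T.LevelsOpen) (i : T.I) :
    ((T.Jhat i).comap toy.ιX).index ≠ 0 := by
  have mem_deltaHat' : ∀ g : Hat, g ∈ toy.DeltaHat := fun g => by
    change g ∈ (1 : Hat →* Gk).ker
    rw [MonoidHom.mem_ker, MonoidHom.one_apply]
  -- `Ĵ_i` is open in `F̂₂`: it is the preimage of `Ĵ_i ∩ Δ̂_X` under the continuous `F̂₂ → Δ̂_X`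
  have hc : Continuous fun x : Hat => (⟨x, mem_deltaHat' x⟩ : toy.DeltaHat) :=
    continuous_id.subtype_mk _
  have hopen : IsOpen ((T.Jhat i : Subgroup Hat) : Set Hat) := by
    have : ((T.Jhat i : Subgroup Hat) : Set Hat) =
        (fun x : Hat => (⟨x, mem_deltaHat' x⟩ : toy.DeltaHat)) ⁻¹'
          (((T.Jhat i).subgroupOf toy.DeltaHat : Subgroup toy.DeltaHat) : Set toy.DeltaHat) := by
      ext x
      simp only [SetLike.mem_coe, Set.mem_preimage, Subgroup.mem_subgroupOf]
    rw [this]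
    exact (hO i).preimage hc
  -- hence of finite index in the compact `F̂₂`, and so is its preimage in `F₂`
  haveI : Finite (Hat ⧸ T.Jhat i) := Subgroup.quotient_finite_of_isOpen _ hopen
  have hidx : (T.Jhat i).index ≠ 0 := Subgroup.index_ne_zero_of_finite
  rw [Subgroup.index_comap]
  exact fun h => hidx (Subgroup.index_eq_zero_of_relIndex_eq_zero h)

/-- **NV-L5, law B2 at the toy for every tower with open levels** (the printed hypothesis, p. 50 l. 27):
`LevelCommTerminal` from `LevelsOpen`, by the two theorems above — the form that composes with
abc-iut-w4-d012's toy tower. ([IUTchI] Cor 2.3(i) p.47) [claim: Mochizuki2012, status: disputed] -/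
theorem levelCommTerminal_free_of_levelsOpen (T : toy.Prop24Tower) (hO : T.LevelsOpen) :
    Prop24Tower.SubgraphLevelData.LevelCommTerminal (T := T) :=
  levelCommTerminal_free T (index_comap_ne_zero_of_levelsOpen T hO)

end FreeModel

end StableCurveTemperedData

end Literature.IUT.HodgeTheaters
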